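import Summits.AnomalousDissipation.AnomalousDissipation.Theorems.SoloInformedLiouvilleStates
import HarnessLib

/-!
# Liouville laminar states V: the inviscid limit — uniform convergence to a profile with no
positive Sobolev regularity
(solo-informed)

The Liouville states `U_ν = (c, R_ν)` of `SoloInformedLiouvilleStates` (one smooth force `f_L`,
exact steady Navier–Stokes states for every `ν > 0`, energy `≤ |c|² + 4`, unbounded enstrophy,
dissipation `ν‖∇U_ν‖² → 0`) are defined by the mode series `R_ν = ∑_n M_{k_n}(z_n(ν))` with
`z_n(ν) = w_n/(iσ_n + νλ_n)`, and the same formula at `ν = 0` gives the formal inviscid profile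
`R_0 = RL 0`, `|z_n(0)| = w_n/|σ_n| = 2^{-n}` (`norm_zL_zero`): a continuous function
(`continuous_RL`, absolutely convergent lacunary series) solving `c·∇R_0 = h` mode by mode.
This file proves, sorry-free, (a) that `R_ν → R_0` and `U_ν → U_0 = (c, R_0)` UNIFORMLY as
`ν → 0` (`tendstoUniformly_RL`, `tendstoUniformly_UL`: termwise continuity of `z_n(ν)` and
Tannery's theorem with the majorant `2·2^{-n}`), (b) that `R_0` solves the steady transport
equation `c·∇R_0 = h` coefficientwise (`fourier_transport_RL_zero`: `iσ_n 𝓕R_0(k_n) = 𝓕h(k_n)`,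
`σ_n = 2π c·k_n`), and (c) that `R_0` lies OUTSIDE the Sobolev space `H^s(T²)` for EVERY
`s > 0` (`eSobolevNorm_RL_zero_eq_top`, `not_memSobolev_RL_zero`): the single Fourier
coefficient at the Liouville frequency `k_n = (b_n, a_n)`, `b_n = 2^{(n+2)!}`, contributes
`(1+|k_n|²)^s |z_n(0)|²/4 ≥ b_n^{2s} 4^{-n}/4 ≥ 4^{n+1} 4^{-n}/4 = 1` as soon as `s(n+2) ≥ 1`
(`s·(n+2)! ≥ s(n+2)(n+1) ≥ n+1`), so the terms of the `H^s` series do not tend to zero.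
Reading (wall r25, addendum 2): the vanishing-viscosity profile selected by ONE smooth force in
this exact class is Onsager-supercritical at every positive exponent and yet carries no
dissipation — roughness of the limit (necessary for the zeroth law by the long-time Onsager
theorem, `SoloInformedLongTimeOnsager`) is maximally insufficient.

References: J. Liouville (1851) / Mathlib `LiouvilleNumber`; L. Grafakos, *Classical Fourier
Analysis* (2014) Prop. 3.2.6–3.3.12 [Grafakos2014]; A. Cheskidov, arXiv:2311.04182 §3 and
E. Bruè, C. De Lellis, CMP 400 (2023) §3 (the `2½`-dimensional ansatz) [Cheskidov2023,
BrueDeLellis2023].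
-/

noncomputable section

open MeasureTheory Filter Topology Set UnitAddTorus
open scoped ENNReal NNReal Real

namespace Summit.AnomalousDissipation.AnomalousDissipation.Theorems

open Literature.Analysis.FunctionSpaces Literature.Analysis.FunctionSpaces.Torus
  Literature.Analysis.FluidPDE

section InviscidLimit


/-- A single real mode is continuous. [folklore] -/
theorem continuous_rmode {d : Type*} [Fintype d] [DecidableEq d] (k : d → ℤ) (z : ℂ) :
    Continuous (rmode k z) :=
  Complex.continuous_re.comp ((mFourier k).continuous.mul continuous_const)

/-- The Liouville response profile `R_ν` is continuous for EVERY `ν`, including the inviscid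
profile `R_0` (uniformly absolutely convergent series, `∑_n |z_n(ν)| ≤ 2`). [folklore] -/
theorem continuous_RL (ν : ℝ) : Continuous (RL ν) :=
  continuous_tsum (fun n => continuous_rmode (kL n) (zL ν n)) (summable_norm_zL ν)
    fun n y => norm_rmode_le (kL n) (zL ν n) y

/-- At `ν = 0` the response coefficient has modulus exactly `2^{-n}`:
`|z_n(0)| = w_n/|σ_n|`. [folklore] -/
theorem norm_zL_zero (n : ℕ) : ‖zL 0 n‖ = (1 / 2 : ℝ) ^ n := by
  have hden : den 0 n = (σL n : ℂ) * Complex.I := by simp [den]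
  have hσ : |σL n| ≠ 0 := abs_ne_zero.mpr (σL_ne_zero n)
  rw [zL, hden, norm_div, norm_mul, Complex.norm_I, mul_one, Complex.norm_real, Complex.norm_real,
    Real.norm_eq_abs, Real.norm_eq_abs, abs_of_pos (wL_pos n), wL_eq, mul_div_right_comm,
    div_self hσ, one_mul]

/-- Factorial growth beats every slope: `n + 1 ≤ s·(n+2)!` once `s(n+2) ≥ 1`. [folklore] -/
theorem succ_le_mul_factorial {s : ℝ} (hs : 0 ≤ s) {n : ℕ} (hn : 1 ≤ s * (n + 2)) :
    (n + 1 : ℝ) ≤ s * ((n + 2).factorial : ℝ) := by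
  have hf : ((n + 2 : ℕ) : ℝ) * ((n + 1 : ℕ) : ℝ) ≤ ((n + 2).factorial : ℝ) := by
    have h1 : (n + 2).factorial = (n + 2) * (n + 1).factorial := Nat.factorial_succ (n + 1)
    have h2 : n + 1 ≤ (n + 1).factorial := Nat.self_le_factorial (n + 1)
    have : (n + 2) * (n + 1) ≤ (n + 2).factorial := by
      rw [h1]; exact Nat.mul_le_mul le_rfl h2
    exact_mod_cast this
  push_cast at hf
  have hn1 : (0 : ℝ) ≤ n + 1 := by positivity
  calc (n + 1 : ℝ) = 1 * (n + 1) := by ring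
    _ ≤ (s * (n + 2)) * (n + 1) := by gcongr
    _ = s * ((n + 2) * (n + 1)) := by ring
    _ ≤ s * (n + 2).factorial := by gcongr

/-- The Liouville denominator dominates `4^{n+1}` at every positive Sobolev exponent:
`b_n^{2s} = 2^{2s (n+2)!} ≥ 2^{2(n+1)}` once `s(n+2) ≥ 1`. [folklore] -/
theorem four_pow_le_bL_rpow {s : ℝ} (hs : 0 ≤ s) {n : ℕ} (hn : 1 ≤ s * (n + 2)) :
    (4 : ℝ) ^ (n + 1) ≤ (bL n : ℝ) ^ (2 * s) := by
  have hb : (bL n : ℝ) = (2 : ℝ) ^ (n + 2).factorial := by simp [bL]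
  have hexp : (((2 * (n + 1) : ℕ) : ℝ)) ≤ ((n + 2).factorial : ℝ) * (2 * s) := by
    have := succ_le_mul_factorial hs hn
    push_cast; nlinarith
  calc (4 : ℝ) ^ (n + 1) = (2 : ℝ) ^ (2 * (n + 1)) := by
        rw [show (4 : ℝ) = 2 ^ 2 by norm_num, ← pow_mul]
    _ = (2 : ℝ) ^ (((2 * (n + 1) : ℕ) : ℝ)) := (Real.rpow_natCast _ _).symm
    _ ≤ (2 : ℝ) ^ (((n + 2).factorial : ℝ) * (2 * s)) :=
        Real.rpow_le_rpow_of_exponent_le (by norm_num) hexp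
    _ = ((2 : ℝ) ^ ((n + 2).factorial : ℝ)) ^ (2 * s) := Real.rpow_mul (by norm_num) _ _
    _ = (bL n : ℝ) ^ (2 * s) := by rw [Real.rpow_natCast, hb]

/-- The squared Sobolev weight is `(1+|k|²)^s`. [folklore] -/
theorem sobolevWeight_sq_eq (s : ℝ) (n : ℕ) :
    sobolevWeight s (kL n) ^ 2 = (1 + freqNormSq (kL n)) ^ s := by
  have hq : 0 ≤ freqNormSq (kL n) := le_trans (sq_nonneg _) (bL_sq_le_freqNormSq n)
  have h0 : 0 ≤ 1 + freqNormSq (kL n) := by linarith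
  rw [sobolevWeight, ← Real.rpow_natCast, ← Real.rpow_mul h0,
    show s / 2 * ((2 : ℕ) : ℝ) = s by push_cast; ring]

/-- Lower bound for the `n`-th term of the `H^s` series of `R_0` beyond the threshold
`s(n+2) ≥ 1`: `(1+|k_n|²)^s · |z_n(0)/2|² ≥ 1`. [folklore] -/
theorem one_le_sobolevTerm {s : ℝ} (hs : 0 ≤ s) {n : ℕ} (hn : 1 ≤ s * (n + 2)) :
    1 ≤ sobolevWeight s (kL n) ^ 2 * ‖zL 0 n / 2‖ ^ 2 := by
  have hq : (bL n : ℝ) ^ 2 ≤ 1 + freqNormSq (kL n) := by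
    have := bL_sq_le_freqNormSq n; linarith
  have hb0 : 0 ≤ (bL n : ℝ) := Nat.cast_nonneg _
  have hw : (bL n : ℝ) ^ (2 * s) ≤ sobolevWeight s (kL n) ^ 2 := by
    rw [sobolevWeight_sq_eq]
    calc (bL n : ℝ) ^ (2 * s) = ((bL n : ℝ) ^ (2 : ℕ)) ^ s := by
          rw [← Real.rpow_natCast (bL n : ℝ) 2, ← Real.rpow_mul hb0]; norm_num
      _ ≤ (1 + freqNormSq (kL n)) ^ s := Real.rpow_le_rpow (by positivity) hq hs
  have hz : ‖zL 0 n / 2‖ ^ 2 = ((1 / 4 : ℝ) ^ n) / 4 := by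
    rw [norm_div, norm_zL_zero, show ‖(2 : ℂ)‖ = 2 by simp, div_pow, pow_right_comm,
      show ((1 / 2 : ℝ) ^ 2) = 1 / 4 by norm_num]
    norm_num
  have h4 := four_pow_le_bL_rpow hs hn
  have h44 : (4 : ℝ) ^ (n + 1) * ((1 / 4 : ℝ) ^ n / 4) = 1 := by
    rw [pow_succ, one_div_pow]; field_simp
  calc (1 : ℝ) = (4 : ℝ) ^ (n + 1) * ((1 / 4 : ℝ) ^ n / 4) := h44.symm
    _ ≤ (bL n : ℝ) ^ (2 * s) * ((1 / 4 : ℝ) ^ n / 4) := by gcongr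
    _ ≤ sobolevWeight s (kL n) ^ 2 * ‖zL 0 n / 2‖ ^ 2 := by rw [hz]; gcongr

/-- **The inviscid Liouville profile has infinite `H^s` norm for every `s > 0`.**
`‖R_0‖_{H^s} = ∞`: the terms of the Sobolev series at the Liouville frequencies are eventually
`≥ 1`. [folklore] -/
theorem eSobolevNorm_RL_zero_eq_top {s : ℝ} (hs : 0 < s) :
    eSobolevNorm s (fun y : UnitAddTorus (Fin 2) => ((RL 0 y : ℝ) : ℂ)) = ∞ := by
  -- the terms of the Sobolev series along the Liouville frequencies are eventually ≥ 1
  have hterm : ∀ᶠ n : ℕ in atTop, (1 : ℝ≥0∞) ≤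
      ENNReal.ofReal (sobolevWeight s (kL n) ^ 2) *
        ‖mFourierCoeff (fun y : UnitAddTorus (Fin 2) => ((RL 0 y : ℝ) : ℂ)) (kL n)‖ₑ ^ 2 := by
    obtain ⟨N, hN⟩ := exists_nat_ge (1 / s)
    refine eventually_atTop.2 ⟨N, fun n hn => ?_⟩
    have hsn : 1 ≤ s * (n + 2) := by
      have h1 : 1 / s ≤ (n : ℝ) + 2 := by
        have : (N : ℝ) ≤ n := by exact_mod_cast hn
        linarith
      calc (1 : ℝ) = s * (1 / s) := by field_simp
        _ ≤ s * (n + 2) := by gcongr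
    rw [mFourierCoeff_RL 0 n, ← ofReal_norm, ← ENNReal.ofReal_pow (norm_nonneg _),
      ← ENNReal.ofReal_mul (sq_nonneg _), ENNReal.one_le_ofReal]
    exact one_le_sobolevTerm hs.le hsn
  -- hence the full Sobolev series diverges (its terms along `kL` do not tend to zero)
  have hsum : (∑' k, ENNReal.ofReal (sobolevWeight s k ^ 2) *
      ‖mFourierCoeff (fun y : UnitAddTorus (Fin 2) => ((RL 0 y : ℝ) : ℂ)) k‖ₑ ^ 2) = ∞ := by
    by_contra hne
    have hle := ENNReal.tsum_comp_le_tsum_of_injective kL_injective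
      (fun k => ENNReal.ofReal (sobolevWeight s k ^ 2) *
        ‖mFourierCoeff (fun y : UnitAddTorus (Fin 2) => ((RL 0 y : ℝ) : ℂ)) k‖ₑ ^ 2)
    have h0 := ENNReal.tendsto_atTop_zero_of_tsum_ne_top (ne_top_of_le_ne_top hne hle)
    have hlt := h0 (Iio_mem_nhds zero_lt_one)
    obtain ⟨n, hn1, hn2⟩ := (hterm.and hlt).exists
    exact absurd hn2 (not_lt.2 hn1)
  unfold eSobolevNorm
  rw [hsum]
  exact ENNReal.top_rpow_of_pos (by norm_num)

/-- **`R_0 ∉ H^s(T²)` for every `s > 0`** — the vanishing-viscosity profile of the Liouville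
states has no positive Sobolev regularity (while `R_0` is continuous, `continuous_RL 0`).
[folklore] -/
theorem not_memSobolev_RL_zero {s : ℝ} (hs : 0 < s) :
    ¬ MemSobolev s (fun y : UnitAddTorus (Fin 2) => ((RL 0 y : ℝ) : ℂ)) := fun h =>
  absurd h.2 (by rw [eSobolevNorm_RL_zero_eq_top hs]; exact lt_irrefl _)

end InviscidLimit

/-! ## The inviscid limit: `R_ν → R_0` and `U_ν → U_0` uniformly, and the transport equation
for `R_0` -/

section InviscidConvergence


/-- The resonant denominator `iσ_n + νλ_n` depends continuously on `ν ∈ ℝ`. [folklore] -/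
theorem continuous_den (n : ℕ) : Continuous fun ν : ℝ => den ν n := by
  unfold den
  exact continuous_const.add (Complex.continuous_ofReal.comp (continuous_id.mul continuous_const))

/-- Each response coefficient `z_n(ν) = w_n/(iσ_n + νλ_n)` is continuous in `ν` on all of `ℝ`
(the denominator never vanishes because `σ_n ≠ 0`). [folklore] -/
theorem continuous_zL (n : ℕ) : Continuous fun ν : ℝ => zL ν n :=
  show Continuous fun ν : ℝ => (wL n : ℂ) / den ν n from
    continuous_const.div (continuous_den n) fun ν => den_ne_zero ν n

/-- Two profiles differ by a mode series: `R_ν − R_μ = ∑_n M_{k_n}(z_n(ν) − z_n(μ))`. [folklore] -/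
theorem RL_sub_RL (ν μ : ℝ) (y : UnitAddTorus (Fin 2)) :
    RL ν y - RL μ y = modeSeries kL (fun n => zL ν n - zL μ n) y := by
  simp only [RL, modeSeries]
  rw [← (summable_rmode_apply (summable_norm_zL ν) y).tsum_sub
    (summable_rmode_apply (summable_norm_zL μ) y)]
  exact tsum_congr fun n => by rw [sub_eq_iff_eq_add, ← rmode_add, sub_add_cancel]

/-- The coefficient differences are absolutely summable. [folklore] -/
theorem summable_norm_zL_sub (ν μ : ℝ) : Summable fun n => ‖zL ν n - zL μ n‖ :=
  Summable.of_nonneg_of_le (fun _ => norm_nonneg _) (fun _ => norm_sub_le _ _)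
    ((summable_norm_zL ν).add (summable_norm_zL μ))

/-- **Sup-norm control**: `|R_ν(y) − R_μ(y)| ≤ ∑_n |z_n(ν) − z_n(μ)|` for every `y`. [folklore] -/
theorem abs_RL_sub_RL_le (ν μ : ℝ) (y : UnitAddTorus (Fin 2)) :
    |RL ν y - RL μ y| ≤ ∑' n, ‖zL ν n - zL μ n‖ := by
  rw [RL_sub_RL]
  exact abs_modeSeries_le (summable_norm_zL_sub ν μ) y

/-- **Tannery**: `∑_n |z_n(ν) − z_n(0)| → 0` as `ν → 0` (termwise continuity in `ν`,
domination by the summable sequence `2·2^{-n}`). [folklore] -/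
theorem tendsto_tsum_norm_zL_sub_zero :
    Tendsto (fun ν : ℝ => ∑' n, ‖zL ν n - zL 0 n‖) (𝓝 0) (𝓝 0) := by
  have hb : Summable fun n : ℕ => 2 * (1 / 2 : ℝ) ^ n :=
    (summable_geometric_of_lt_one (by norm_num) (by norm_num)).mul_left _
  have hterm : ∀ n : ℕ, Tendsto (fun ν : ℝ => ‖zL ν n - zL 0 n‖) (𝓝 0) (𝓝 0) := fun n => by
    simpa using (((continuous_zL n).tendsto 0).sub_const (zL 0 n)).norm
  have h := tendsto_tsum_of_dominated_convergence (𝓕 := 𝓝 (0 : ℝ))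
    (f := fun ν n => ‖zL ν n - zL 0 n‖) (g := fun _ => (0 : ℝ)) hb hterm
    (Eventually.of_forall fun ν n => by
      rw [Real.norm_eq_abs, abs_of_nonneg (norm_nonneg _)]
      exact (norm_sub_le _ _).trans (by linarith [norm_zL_le ν n, norm_zL_le 0 n]))
  simpa using h

/-- **Uniform convergence of the profiles**: `R_ν → R_0` uniformly on `T²` as `ν → 0`
(along any approach, in particular `ν → 0⁺`). [folklore] -/
theorem tendstoUniformly_RL : TendstoUniformly RL (RL 0) (𝓝 (0 : ℝ)) := by
  refine Metric.tendstoUniformly_iff.2 fun ε hε => ?_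
  filter_upwards [(tendsto_order.1 tendsto_tsum_norm_zL_sub_zero).2 ε hε] with ν hν y
  rw [Real.dist_eq, abs_sub_comm]
  exact (abs_RL_sub_RL_le ν 0 y).trans_lt hν

/-- `U_ν − U_μ = (0, R_ν − R_μ)`, hence `‖U_ν(x) − U_μ(x)‖ = |R_ν(πx) − R_μ(πx)|`. [folklore] -/
theorem norm_UL_sub_UL (ν μ : ℝ) (x : UnitAddTorus (Fin 3)) :
    ‖UL ν x - UL μ x‖ = |RL ν (planarProj x) - RL μ (planarProj x)| := by
  have h : UL ν - UL μ = twoHalf 0 (RL ν - RL μ) := by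
    rw [UL, UL, ← twoHalf_sub, sub_self]
  show ‖(UL ν - UL μ) x‖ = _
  rw [h, Literature.Analysis.FluidPDE.Torus.norm_twoHalf_zero_left, Real.norm_eq_abs, Pi.sub_apply]

/-- **Uniform convergence of the states**: the exact steady Navier–Stokes states `U_ν = (c, R_ν)`
converge uniformly on `T³`, as `ν → 0`, to the bounded continuous field `U_0 = (c, R_0)`.
Together with `SoloInformedLiouvilleDissipation` (`ν‖∇U_ν‖² → 0`) and `not_memSobolev_RL_zero`
(`R_0 ∉ H^s` for every `s > 0`) this is the inviscid-limit picture of the Liouville family: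
a strong (uniform) vanishing-viscosity limit which is rough at every positive Sobolev exponent
and dissipates nothing. [folklore] -/
theorem tendstoUniformly_UL : TendstoUniformly UL (UL 0) (𝓝 (0 : ℝ)) := by
  refine Metric.tendstoUniformly_iff.2 fun ε hε => ?_
  filter_upwards [Metric.tendstoUniformly_iff.1 tendstoUniformly_RL ε hε] with ν hν x
  rw [dist_eq_norm, norm_UL_sub_UL, ← Real.dist_eq]
  exact hν (planarProj x)

/-- `σ_n = 2π c·k_n`: the imaginary part of the resonant denominator is the symbol of the
drift `c·∇` at the Liouville frequency `k_n`. [folklore] -/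
theorem σL_eq_two_pi_mul_dot (n : ℕ) : σL n = 2 * Real.pi * ∑ j, cL j * (kL n j : ℝ) := by
  rw [sum_cL_mul_kL, σL]; ring

/-- **The inviscid profile solves the steady transport equation `c·∇R_0 = h` coefficientwise**:
`(2πi c·k_n) 𝓕R_0(k_n) = iσ_n z_n(0)/2 = w_n/2 = 𝓕h(k_n)` at every Liouville frequency
(and both sides are supported on `{±k_n}`, `mFourierCoeff_modeSeries`). Since `R_0` is only
continuous (`continuous_RL 0`, `not_memSobolev_RL_zero`), this Fourier-side identity is the
distributional form of the equation: `U_0 = (c, R_0)` is a bounded continuous steady weak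
solution of the forced Euler/transport system with the same force `f_L`. [folklore] -/
theorem fourier_transport_RL_zero (n : ℕ) :
    (σL n : ℂ) * Complex.I *
        mFourierCoeff (fun y : UnitAddTorus (Fin 2) => ((RL 0 y : ℝ) : ℂ)) (kL n) =
      mFourierCoeff (fun y : UnitAddTorus (Fin 2) => ((hL y : ℝ) : ℂ)) (kL n) := by
  have hh : mFourierCoeff (fun y : UnitAddTorus (Fin 2) => ((hL y : ℝ) : ℂ)) (kL n) =
      (wL n : ℂ) / 2 :=
    mFourierCoeff_modeSeries_eq rapidDecay_wL.summable_norm kL_injective kL_ne_neg n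
  have hden : den 0 n = (σL n : ℂ) * Complex.I := by simp [den]
  rw [mFourierCoeff_RL, hh, mul_div_assoc', ← hden, den_mul_zL]

end InviscidConvergence

end Summit.AnomalousDissipation.AnomalousDissipation.Theorems

end
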